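import Literature.RingTheory.FormalGroups.FormalOModuleBudLift
import HarnessLib

/-!
# Formal `𝒪`-module laws lift along surjections of `𝒪`-algebras
# ([Drinfeld 1974] §1 Prop. 1.4 «Λ_𝒪 ≅ 𝒪[g₁, g₂, …]» ⇒ lifting; [Lazard 1955] Thm. II–III; [Hazewinkel 1978] §21.5)

Topic `Literature/RingTheory/FormalGroups`; namespace `Literature.RingTheory.FormalGroups`.  Two plumbing definitions (the lifted
bud tower `liftSeq` and its limit law `liftLaw`) + fully proved theorems; no named fact, no instance, no notation, no `sorry`.
Cell `hodgecm-mathlib`, P6 «MOD programme», sub-line P6d: THIS IS THE LITERATURE FORM OF THE CRUX STUB `stub_L4B3cO`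
(`FormalOModuleLiftsAlongSurjection 𝒪 p`): for `𝒪` a discrete valuation ring with finite residue field of characteristic `p`
(completeness is NOT needed) and a surjective `𝒪`-algebra map `π : A′ ↠ A`, every (one-dimensional) formal `𝒪`-module law over
`A` is the base change along `π` of a formal `𝒪`-module law over `A′` — law AND action lift jointly
(`FormalOModuleLaw.exists_lift_of_surjective`).

Proof (Drinfeld's road, bud by bud): starting from the additive `1`-bud over `A′`, ★ `budLift` corrects an `n`-bud over `A′`
lying over the law `mod deg n+1` into an `(n+1)`-bud lying over it `mod deg n+2`, congruent to the previous one `mod deg n+1`;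
the coefficientwise limit of this tower is an exact formal `𝒪`-module law over `A′` (all its defects have infinite order) mapping
to the given one.
-/

noncomputable section

namespace Literature.RingTheory.FormalGroups

open MvPowerSeries (HasSubst subst X order coeff)
open Finset Finsupp

universe u w w'

variable {𝒪 : Type u} [CommRing 𝒪] [IsDomain 𝒪] [IsDiscreteValuationRing 𝒪] [Finite (IsLocalRing.ResidueField 𝒪)]
  (p : ℕ) [Fact p.Prime] [CharP (IsLocalRing.ResidueField 𝒪) p]
  {A : Type w} {A' : Type w'} [CommRing A] [Algebra 𝒪 A] [CommRing A'] [Algebra 𝒪 A']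
  (π : A' →ₐ[𝒪] A) (hπ : Function.Surjective π) (M : FormalOModuleLaw 𝒪 A)

/-! ## §1 The tower of lifted buds -/

/-- Level `n` of the tower: an `(n+1)`-bud over `A′` lying over `M` `mod deg n+2` (private plumbing). [folklore] -/
private def LiftData (n : ℕ) : Type (max u w') :=
  {x : MvPowerSeries (Fin 2) A' × (𝒪 → PowerSeries A') // IsOModuleBud 𝒪 (n + 1) x.1 x.2 ∧
    ((n + 2 : ℕ) : ℕ∞) ≤ (MvPowerSeries.map π.toRingHom x.1 - M.toFormalGroup.toPowerSeries).order ∧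
    ∀ a, ((n + 2 : ℕ) : ℕ∞) ≤ MvPowerSeries.order (PowerSeries.map π.toRingHom (x.2 a) - (M.act a).toPowerSeries)}

include p hπ in
/-- The successor step: ★ `budLift` applied to level `n`, remembering the congruence with level `n`. [cite: Drinfeld1974, §1 Prop. 1.4] -/
private theorem exists_liftData_succ (n : ℕ) (d : LiftData π M n) :
    ∃ y : LiftData π M (n + 1), ((n + 2 : ℕ) : ℕ∞) ≤ (y.1.1 - d.1.1).order ∧
      ∀ a, ((n + 2 : ℕ) : ℕ∞) ≤ MvPowerSeries.order (y.1.2 a - d.1.2 a) := by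
  obtain ⟨⟨F, ρ⟩, hb, hF, hρ⟩ := d
  obtain ⟨F', ρ', h', hF'F, hρ'ρ, hF'M, hρ'M⟩ := budLift (𝒪 := 𝒪) p (k := n + 1) (by omega) A' A π hπ _ _
    (M.isOModuleBud (n + 1 + 1)) F ρ hb hF hρ
  exact ⟨⟨(F', ρ'), h', hF'M, hρ'M⟩, hF'F, hρ'ρ⟩

/-- Level `0`: the additive `1`-bud. [cite: Drinfeld1974, §1 Prop. 1.4] -/
private def liftDataZero : LiftData π M 0 := by
  refine ⟨(X 0 + X 1, fun a => algebraMap 𝒪 A' a • PowerSeries.X), isOModuleBud_additive 𝒪 A' 1, ?_, fun a => ?_⟩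
  · rw [map_add, MvPowerSeries.map_X, MvPowerSeries.map_X,
      show (X 0 + X 1 : MvPowerSeries (Fin 2) A) - M.toFormalGroup.toPowerSeries = -(M.toFormalGroup.toPowerSeries - X 0 - X 1)
        by ring, MvPowerSeries.order_neg]
    exact (M.isOModuleBud 0).two_le_order_F
  · have e : PowerSeries.map π.toRingHom (algebraMap 𝒪 A' a • (PowerSeries.X : PowerSeries A')) - (M.act a).toPowerSeries =
        -((M.act a).toPowerSeries - algebraMap 𝒪 A a • PowerSeries.X) := by
      rw [PowerSeries.smul_eq_C_mul, map_mul, PowerSeries.map_C, PowerSeries.map_X, ← PowerSeries.smul_eq_C_mul]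
      change π (algebraMap 𝒪 A' a) • _ - _ = _
      rw [π.commutes]; ring
    rw [e, MvPowerSeries.order_neg]; exact (M.isOModuleBud 0).two_le_order_ρ a

/-- **The tower of lifted buds** (choice at each step). [cite: Drinfeld1974, §1 Prop. 1.4] -/
private def liftSeq (hπ : Function.Surjective π) : (n : ℕ) → LiftData π M n
  | 0 => liftDataZero π M
  | n + 1 => Classical.choose (exists_liftData_succ p π hπ M n (liftSeq hπ n))

/-- Consecutive levels agree `mod deg n+2`. [cite: Drinfeld1974, §1 Prop. 1.4] -/
private theorem liftSeq_succ_congr (n : ℕ) :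
    ((n + 2 : ℕ) : ℕ∞) ≤ ((liftSeq p π M hπ (n + 1)).1.1 - (liftSeq p π M hπ n).1.1).order ∧
      ∀ a, ((n + 2 : ℕ) : ℕ∞) ≤ MvPowerSeries.order ((liftSeq p π M hπ (n + 1)).1.2 a - (liftSeq p π M hπ n).1.2 a) :=
  Classical.choose_spec (exists_liftData_succ p π hπ M n (liftSeq p π M hπ n))

/-- Levels `n ≤ m` agree in degrees `≤ n + 1`. [cite: Drinfeld1974, §1 Prop. 1.4] -/
private theorem coeff_liftSeq_eq {n m : ℕ} (hnm : n ≤ m) :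
    (∀ d : Fin 2 →₀ ℕ, d.degree ≤ n + 1 → coeff d (liftSeq p π M hπ m).1.1 = coeff d (liftSeq p π M hπ n).1.1) ∧
      ∀ (a : 𝒪) (d : Unit →₀ ℕ), d.degree ≤ n + 1 →
        coeff d ((liftSeq p π M hπ m).1.2 a) = coeff d ((liftSeq p π M hπ n).1.2 a) := by
  induction m, hnm using Nat.le_induction with
  | base => exact ⟨fun _ _ => rfl, fun _ _ _ => rfl⟩
  | succ m hnm ih =>
    obtain ⟨h1, h2⟩ := liftSeq_succ_congr p π hπ M m
    refine ⟨fun d hd => ?_, fun a d hd => ?_⟩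
    · rw [← (ih.1 d hd)]; exact (natCast_le_order_sub_iff.1 h1) d (by omega)
    · rw [← (ih.2 a d hd)]; exact (natCast_le_order_sub_iff.1 (h2 a)) d (by omega)

/-! ## §2 The limit law -/

/-- The limit series `F∞(d) = [X^d] F_{|d|}`. [cite: Drinfeld1974, §1 Prop. 1.4] -/
private def limF : MvPowerSeries (Fin 2) A' := fun d => coeff d (liftSeq p π M hπ d.degree).1.1

/-- The limit action `ρ∞_a = Σ_n [X^n](ρ_n)_a X^n`. [cite: Drinfeld1974, §1 Prop. 1.4] -/
private def limρ (a : 𝒪) : PowerSeries A' := PowerSeries.mk fun n => PowerSeries.coeff n ((liftSeq p π M hπ n).1.2 a)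

/-- The limit agrees with level `n` `mod deg n+2`. [cite: Drinfeld1974, §1 Prop. 1.4] -/
private theorem lim_congr (n : ℕ) :
    ((n + 2 : ℕ) : ℕ∞) ≤ (limF p π hπ M - (liftSeq p π M hπ n).1.1).order ∧
      ∀ a, ((n + 2 : ℕ) : ℕ∞) ≤ MvPowerSeries.order (limρ p π hπ M a - (liftSeq p π M hπ n).1.2 a) := by
  refine ⟨natCast_le_order_sub_iff.2 fun d hd => ?_, fun a => natCast_le_order_sub_iff.2 fun d hd => ?_⟩
  · change coeff d (liftSeq p π M hπ d.degree).1.1 = _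
    rcases Nat.lt_or_ge d.degree n with h | h
    · exact ((coeff_liftSeq_eq p π hπ M h.le).1 d (Nat.le_succ _)).symm
    · exact (coeff_liftSeq_eq p π hπ M h).1 d (by omega)
  · have hd1 : d = single () (d ()) := Finsupp.ext fun u => by obtain ⟨⟩ := u; simp
    have hdeg : (single () (d ())).degree = d () := by rw [degree_single]
    rw [hd1, ← PowerSeries.coeff_def (s := single () (d ())) (n := d ()) (by simp), limρ, PowerSeries.coeff_mk,
      PowerSeries.coeff_def (s := single () (d ())) (n := d ()) (by simp)]
    rcases Nat.lt_or_ge (d ()) n with h | h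
    · exact ((coeff_liftSeq_eq p π hπ M h.le).2 a _ (by rw [hdeg]; omega)).symm
    · exact (coeff_liftSeq_eq p π hπ M h).2 a _ (by rw [hdeg]; rw [hd1, hdeg] at hd; omega)

/-- The limit is an `(n+1)`-bud for every `n`. [cite: Drinfeld1974, §1 Prop. 1.4] -/
private theorem lim_isOModuleBud (n : ℕ) : IsOModuleBud 𝒪 (n + 1) (limF p π hπ M) (limρ p π hπ M) := by
  obtain ⟨hF, hρ⟩ := lim_congr p π hπ M n
  refine (liftSeq p π M hπ n).2.1.congr (by omega) ?_ (fun a => ?_) hF hρ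
  · change coeff 0 (liftSeq p π M hπ (0 : Fin 2 →₀ ℕ).degree).1.1 = 0
    rw [MvPowerSeries.coeff_zero_eq_constantCoeff_apply]; exact (liftSeq p π M hπ _).2.1.constantCoeff_F
  · rw [← PowerSeries.coeff_zero_eq_constantCoeff_apply, limρ, PowerSeries.coeff_mk, PowerSeries.coeff_zero_eq_constantCoeff_apply]
    exact (liftSeq p π M hπ 0).2.1.constantCoeff_ρ a

/-- An `ℕ∞` bounded below by every natural number is `⊤`. [folklore] -/
private theorem eq_top_of_forall_le {x : ℕ∞} (h : ∀ n : ℕ, (n : ℕ∞) ≤ x) : x = ⊤ := by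
  by_contra hx
  obtain ⟨m, rfl⟩ := ENat.ne_top_iff_exists.1 hx
  have := h (m + 1)
  exact absurd (by exact_mod_cast this : m + 1 ≤ m) (by omega)

/-- **The limit formal `𝒪`-module law over `A′`.** [cite: Drinfeld1974, §1 Prop. 1.4] -/
private def liftLaw : FormalOModuleLaw 𝒪 A' := by
  have bud := lim_isOModuleBud p π hπ M
  have hlin := (natCast_le_order_sub_iff.1 (bud 0).two_le_order_F)
  have hassoc : assocDefect (limF p π hπ M) = 0 :=
    MvPowerSeries.order_eq_top_iff.1 (eq_top_of_forall_le fun n => natCast_le_order_of_le (bud n).assoc (by omega))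
  have hcomm : commDefect (limF p π hπ M) = 0 :=
    MvPowerSeries.order_eq_top_iff.1 (eq_top_of_forall_le fun n => natCast_le_order_of_le (bud n).comm (by omega))
  have hhom : ∀ a, homDefect (limF p π hπ M) (limρ p π hπ M a) = 0 := fun a =>
    MvPowerSeries.order_eq_top_iff.1 (eq_top_of_forall_le fun n => natCast_le_order_of_le ((bud n).hom a) (by omega))
  have hadd : ∀ a b, addDefect (limF p π hπ M) (limρ p π hπ M a) (limρ p π hπ M b) (limρ p π hπ M (a + b)) = 0 := fun a b =>
    MvPowerSeries.order_eq_top_iff.1 (eq_top_of_forall_le fun n => natCast_le_order_of_le ((bud n).add a b) (by omega))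
  have hmul : ∀ a b, mulDefect (limρ p π hπ M a) (limρ p π hπ M b) (limρ p π hπ M (a * b)) = 0 := fun a b =>
    MvPowerSeries.order_eq_top_iff.1 (eq_top_of_forall_le fun n => natCast_le_order_of_le ((bud n).mul a b) (by omega))
  have hone : limρ p π hπ M 1 - PowerSeries.X = 0 :=
    MvPowerSeries.order_eq_top_iff.1 (eq_top_of_forall_le fun n => natCast_le_order_of_le (bud n).one (by omega))
  have hzero : limρ p π hπ M 0 = 0 :=
    MvPowerSeries.order_eq_top_iff.1 (eq_top_of_forall_le fun n => natCast_le_order_of_le (bud n).zero (by omega))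
  let F : FormalGroup A' :=
    { toPowerSeries := limF p π hπ M
      zero_constantCoeff := (bud 0).constantCoeff_F
      lin_coeff_X := by
        classical
        have h := hlin (single 0 1) (by rw [degree_single]; norm_num)
        simpa [MvPowerSeries.coeff_index_single_X, sub_eq_zero] using h
      lin_coeff_Y := by
        classical
        have h := hlin (single 1 1) (by rw [degree_single]; norm_num)
        simpa [MvPowerSeries.coeff_index_single_X, sub_eq_iff_eq_add] using h
      assoc := sub_eq_zero.1 hassoc }
  exact
    { toFormalGroup := F
      isComm := ⟨sub_eq_zero.1 hcomm⟩
      act := fun a =>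
        { toPowerSeries := limρ p π hπ M a
          constantCoeff_eq_zero := (bud 0).constantCoeff_ρ a
          map_add := sub_eq_zero.1 (hhom a) }
      coeff_one_act := fun a => (bud 0).coeff_one_ρ a
      act_zero := hzero
      act_one := sub_eq_zero.1 hone
      act_add := fun a b => sub_eq_zero.1 (hadd a b)
      act_mul := fun a b => sub_eq_zero.1 (hmul a b) }

/-! ## §3 The lifting theorem -/

include p hπ in
/-- **Formal `𝒪`-module laws lift along surjections** (`𝒪` a DVR with finite residue field of characteristic `p`; `π : A′ ↠ A`
a surjective `𝒪`-algebra map): every formal `𝒪`-module law over `A` is the base change of one over `A′` — law and `𝒪`-action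
jointly.  This is the content of Drinfeld's «`Λ_𝒪` is a polynomial ring» used by the Lubin–Tate ∕ Drinfeld deformation theory
(unobstructedness). [cite: Drinfeld1974, §1 Prop. 1.4] [cite: Hazewinkel1978, §21.5] [cite: Lazard1955, Thm. II–III] -/
theorem FormalOModuleLaw.exists_lift_of_surjective :
    ∃ M' : FormalOModuleLaw 𝒪 A',
      MvPowerSeries.map π.toRingHom M'.toFormalGroup.toPowerSeries = M.toFormalGroup.toPowerSeries ∧
      ∀ a, PowerSeries.map π.toRingHom (M'.act a).toPowerSeries = (M.act a).toPowerSeries := by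
  refine ⟨liftLaw p π hπ M, ?_, fun a => ?_⟩
  · ext d
    change π (coeff d (liftSeq p π M hπ d.degree).1.1) = _
    have h := (natCast_le_order_sub_iff.1 (liftSeq p π M hπ d.degree).2.2.1) d (by omega)
    rw [MvPowerSeries.coeff_map] at h
    exact h
  · ext n
    change PowerSeries.coeff n (PowerSeries.map π.toRingHom (limρ p π hπ M a)) = _
    rw [PowerSeries.coeff_map, limρ, PowerSeries.coeff_mk]
    have h := (natCast_le_order_sub_iff.1 ((liftSeq p π M hπ n).2.2.2 a)) (single () n) (by rw [degree_single]; omega)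
    have h' : PowerSeries.coeff n (PowerSeries.map π.toRingHom ((liftSeq p π M hπ n).1.2 a)) =
        PowerSeries.coeff n (M.act a).toPowerSeries := by
      rw [PowerSeries.coeff_def (s := single () n) (n := n) (by simp)]; exact h
    rw [PowerSeries.coeff_map] at h'
    exact h'

end Literature.RingTheory.FormalGroups
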